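import Summits.FinalStateConjecture.FinalStateConjecture.Theorems.PhotonSphereChannelsDarkFutureDefs
import Summits.FinalStateConjecture.FinalStateConjecture.Theorems.PhotonSphereChannelsChannelsResolveTameDevelopmentsRFlatEndExplicit
import Summits.FinalStateConjecture.FinalStateConjecture.Theorems.PhotonSphereChannelsChannelsResolveTameDevelopmentsRFlatTameEnd
import Summits.FinalStateConjecture.FinalStateConjecture.Theorems.PhotonSphereChannelsChannelsResolveTameDevelopmentsRKerrFlatChartRigidity
import Literature.Geometry.Lorentzian.KerrCollarConvergence
import HarnessLib

/-!
# Route PhotonSphereChannels · crux `ChannelsResolveTameDevelopmentsR` (K2R-T2, stmt-FinalStateConjecture-17430) —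
# the closed pieces around the bridge stub B′ `stub_darkFutureExactness` (line `dark-future-exactness`, Reshape 1):
# API of the slab hypothesis, tightness over the flat end, exclusion of the flat end at order `≥ 2`

The bridge stub B′ of the skeleton `Cruxes/ChannelsResolveTameDevelopmentsR/Lines/dark_future_exactness.lean` reads:
in every all-orders class `IsTameClass E Λ r₀`, for every sub-extremal `(M, a)` and every DEPTH `ρ ∈ (r₋, r₊)` there
are an order `k` and a weight `β < 2` such that every SILENT end that is `δ`-slab-close from depth `ρ`
(`IsSlabClose 𝓢 E M' a' ρ k β c δ`, `Theorems/PhotonSphereChannelsDarkFutureDefs.lean`) to a Kerr `(M', a')` near `(M, a)`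
has a domain of outer communications EXACTLY Kerr (`IsKerrDoc`). Its content is nonlinear Kerr stability used as exactness
(blocked on `hintz_kerr_stability_subextremal_cauchy` / `klainerman_szeftel_kerr_stability_small_a_cauchy` plus undeclared
rigidity and backward-extension steps; lead's `work/stubs/stub_darkFutureExactness.md`). This file lands what IS closed:

* §1 API of the posited predicates (namespace `TameHull`): slab closeness is monotone in the order
  (`IsSlabClose.of_order_le`) and ANTITONE IN THE DEPTH up to the horizon (`IsSlabClose.of_depth_le`: restrict the
  penetrating chart along `Kerr.region a ρ' ≤ Kerr.region a ρ`; the deviation, its jets, the coverage of the clock epoch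
  and the orientation are unchanged — `Spacetime.deviationExtend_comp_inclusion_of_mem`); an exactly-Kerr d.o.c. is
  eventually exactly Kerr for every threshold (`isEventuallyKerrDoc_of_isKerrDoc`), thresholds may be raised
  (`IsEventuallyKerrDoc.of_le`), and a threshold below the clock range gives back `IsKerrDoc`
  (`isKerrDoc_of_isEventuallyKerrDoc_of_forall_lt`). Consequence for B′ (namespace `DarkFuture`,
  `darkFutureExactnessAt_of_depth_le`): the body of B′ at a depth `ρ' < r₊(M, a)` implies it at every deeper `ρ ≤ ρ'`
  (continuity of `r₊` keeps `ρ'` below `r₊(M', a')` for near parameters) — B′ `∀ ρ ∈ (r₋, r₊)` is exactly as strong as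
  B′ for depths arbitrarily close to `r₊`, i.e. from arbitrarily THIN collars.
* §2 TIGHTNESS over the landed flat end (`…RFlatEndExplicit`, `…RFlatTameEnd`): the explicit flat end
  `EndDatum.mk 0 1 0 Subtype.val (fun x ↦ x 0)` of Minkowski spacetime lies in `IsTameClass Λ r₀` for every `Λ` with
  `1 ≤ Λ 0` and every `r₀ > 0` (`isTameClass_flatEnd`), is silent, and admits no Kerr d.o.c. of positive mass
  (`FlatEnd.not_isKerrDoc_minkowski`, Kretschmann); hence B′ WITH THE HYPOTHESIS `IsSlabClose` DELETED IS FALSE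
  (registered sub-goal `not_darkFutureExactness_without_slab`; class-wise form `not_darkFutureExactness_without_slab_of_le`).
* §3 … and the slab hypothesis does exclude that witness as soon as `k ≥ 2`: NO end of Minkowski spacetime is
  `δ`-slab-close at order `k ≥ 2` to a Kerr of positive mass from any depth, for `δ` below a constant of
  `(M, a, ρ, k, β)` (registered sub-goal `not_isSlabClose_minkowski_of_two_le`; pointwise `C²` Kretschmann rigidity
  `HullCurvature.not_forall_weighted_jets_le_of_flatChart` of `…RKerrFlatChartRigidity` at an equatorial point of the
  chart slab). At `k ≤ 1` nothing in the tree excludes it: any proof of B′ must use the deviation clause at order `≥ 2`.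

Not landed (kept kernel-checked in the lead's folder, `work/stubs/w2_stub_darkFutureExactness.lean`): the reduction
`B′ ⇐ F3′ SlabForwardStability(ρ) ∧ F1 DarkLateRigidity ∧ F2 BackwardExtension` over closed `Prop`s.

## References

* S. Klainerman, J. Szeftel, *Kerr stability for small angular momentum*, PAMQ 19 (2023), Thm. 1.2.1, §3.1.1. [KlainermanSzeftel2023]
* M. Dafermos, J. Luk, arXiv:1710.01722, Conjecture 1. [DafermosLuk2017]
* M. T. Anderson, Cheeger–Gromov theory and applications to general relativity (2004), Def. 1.1. [Anderson2004]
* M. Visser, arXiv:0706.0622, §3. [arXiv07060622]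
* B. Kotschwar, Comm. Anal. Geom. 22 (2014), §1.1 (8). [Kotschwar2014]
-/

noncomputable section

-- the operator-norm instance on `E4 →L[ℝ] E4 →L[ℝ] ℝ` needs one more level of pending
-- instance problems than the default (as in `PhotonSphereChannelsTameHullDefs.lean`)
set_option maxSynthPendingDepth 3
-- every `Summit.FinalStateConjecture.FinalStateConjecture.…` name repeats the summit = sub-problem segment (D-0017 layout)
set_option linter.dupNamespace false

open Set Filter Function TopologicalSpace Manifold Bundle
open scoped Topology Manifold ContDiff ENNReal NNReal

/-! ### §1 API of `IsSlabClose` (order, depth) and of `IsEventuallyKerrDoc` (thresholds) -/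

namespace Summit.FinalStateConjecture.FinalStateConjecture.Theorems.TameHull

open Literature.Geometry.Lorentzian

/-- The penetrating background of the line is the generic Kerr–Schild region background of
`KerrFramedCompactness` (same record, by `rfl`), so the chart calculus of the `Literature` applies verbatim.
[cite: KlainermanSzeftel2023, §3.1.1] -/
theorem penetratingBackground_eq_regionBackground (M a ρ : ℝ) :
    penetratingBackground M a ρ = Kerr.regionBackground M a ρ := rfl

/-- Slab closeness is monotone in the order: order `k` gives every order `k' ≤ k` (same chart, fewer jets).
[cite: KlainermanSzeftel2023, Thm. 1.2.1] -/
theorem IsSlabClose.of_order_le {𝓢 : Spacetime.{0} 4} {E : EndDatum 𝓢} {M a ρ : ℝ} {k k' : ℕ} {β c δ : ℝ}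
    (h : IsSlabClose 𝓢 E M a ρ k β c δ) (hk : k' ≤ k) : IsSlabClose 𝓢 E M a ρ k' β c δ := by
  obtain ⟨Ψ, hinj, hsm, hdoc, hcov, hdev, hfut⟩ := h
  exact ⟨Ψ, hinj, hsm, hdoc, hcov, fun m hm x hx ↦ hdev m (hm.trans hk) x hx, hfut⟩

/-- Chain rule along the inclusion of Kerr–Schild regions: `d(Ψ ∘ ι)(x) v = dΨ(ι x) v` (the inclusion of open
subsets of `E4` has identity differential, `OpensChart.mfderiv_inclusion_apply`). [folklore] -/
private theorem mfderiv_comp_inclusion_apply {𝓢 : Spacetime.{0} 4} {U V : Opens E4} (h : U ≤ V)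
    {Ψ : V → 𝓢.carrier} (hΨ : ContMDiff 𝓘(ℝ, E4) (𝓡 4) ∞ Ψ) (x : U) (v : E4) :
    mfderiv 𝓘(ℝ, E4) (𝓡 4) (Ψ ∘ Opens.inclusion h) x v =
      mfderiv 𝓘(ℝ, E4) (𝓡 4) Ψ (Opens.inclusion h x) v := by
  rw [mfderiv_comp x ((hΨ _).mdifferentiableAt (by simp))
    ((contMDiff_inclusion (n := ∞) h x).mdifferentiableAt (by simp))]
  exact congrArg (mfderiv 𝓘(ℝ, E4) (𝓡 4) Ψ (Opens.inclusion h x))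
    (OpensChart.mfderiv_inclusion_apply h x v)

/-- **Slab closeness is antitone in the depth up to the horizon.** A `δ`-slab-close chart from depth `ρ`
restricts, along `Kerr.region a ρ' ≤ Kerr.region a ρ` (`ρ ≤ ρ' ≤ r₊(M, a)`), to a `δ`-slab-close chart from
depth `ρ'`: injectivity, smoothness and the exterior clause restrict; the covering points have `r > r₊ ≥ ρ'`
so they survive; the extended deviations agree near every point of the smaller (open) region
(`Spacetime.deviationExtend_comp_inclusion_of_mem`), hence so do all their jets; and `d(Ψ ∘ ι) = dΨ`.
[cite: KlainermanSzeftel2023, Thm. 1.2.1] -/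
theorem IsSlabClose.of_depth_le : ∀ {𝓢 : Spacetime.{0} 4} {E : EndDatum 𝓢} {M a ρ ρ' : ℝ} {k : ℕ} {β c δ : ℝ}, IsSlabClose 𝓢 E M a ρ k β c δ → ρ ≤ ρ' → ρ' ≤ Kerr.rPlus M a → IsSlabClose 𝓢 E M a ρ' k β c δ := by
  intro 𝓢 E M a ρ ρ' k β c δ h hρ hρ'
  obtain ⟨Ψ, hinj, hsm, hdoc, hcov, hdev, hfut⟩ := h
  have hle : Kerr.region a ρ' ≤ Kerr.region a ρ := Kerr.region_mono a hρ
  set Ψ' : Kerr.region a ρ' → 𝓢.carrier := Ψ ∘ Opens.inclusion hle with hΨ'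
  refine ⟨Ψ', hinj.comp (Set.inclusion_injective hle), hsm.comp (contMDiff_inclusion hle),
    fun x hx ↦ hdoc (Opens.inclusion hle x) hx, fun q hq hqc ↦ ?_, fun m hm x hx ↦ ?_, fun x hx ↦ ?_⟩
  · obtain ⟨x, hxr, hx0, rfl⟩ := hcov q hq hqc
    have hx' : x.1 ∈ Kerr.region a ρ' :=
      Kerr.mem_region.2 (max_lt (hρ'.trans_lt hxr) (Kerr.radius_pos_of_mem_region x.2))
    exact ⟨⟨x.1, hx'⟩, hxr, hx0, rfl⟩
  · have hev : 𝓢.deviationExtend (penetratingBackground M a ρ') Ψ' =ᶠ[𝓝 x.1]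
        𝓢.deviationExtend (penetratingBackground M a ρ) Ψ := by
      filter_upwards [(Kerr.region a ρ').isOpen.mem_nhds x.2] with y hy
      exact 𝓢.deviationExtend_comp_inclusion_of_mem (B := penetratingBackground M a ρ)
        (B' := penetratingBackground M a ρ') hle (fun _ ↦ rfl) hsm hy
    rw [(hev.iteratedFDeriv ℝ m).eq_of_nhds]
    exact hdev m hm (Opens.inclusion hle x) hx
  · rw [hΨ', mfderiv_comp_inclusion_apply hle hsm x]
    exact hfut (Opens.inclusion hle x) hx

/-- An exactly-Kerr d.o.c. is eventually exactly Kerr, for every threshold `T` (the chart of `IsKerrDoc` covers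
all of `E.doc`): on the exact fibre the conclusion of B′ implies the conclusion of its forward half B1, and the
backward half B2 (`IsEventuallyKerrDoc → IsKerrDoc`) is an honest UPGRADE statement. [cite: DafermosLuk2017, Conjecture 1] -/
theorem isEventuallyKerrDoc_of_isKerrDoc {𝓢 : Spacetime.{0} 4} (E : EndDatum 𝓢) {M a : ℝ}
    (h : IsKerrDoc 𝓢 E.doc M a) (T : ℝ) : IsEventuallyKerrDoc 𝓢 E M a := by
  obtain ⟨Ψ, hinj, hsmooth, hrange, hdev, hfut⟩ := h
  exact ⟨T, Ψ, hinj, hsmooth, hrange.le, fun q hq ↦ hrange.symm ▸ hq.1, hdev, hfut⟩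

/-- Thresholds of `IsEventuallyKerrDoc` may be raised (the late part shrinks). [cite: DafermosLuk2017, Conjecture 1] -/
theorem IsEventuallyKerrDoc.exists_of_le {𝓢 : Spacetime.{0} 4} {E : EndDatum 𝓢} {M a : ℝ}
    (h : IsEventuallyKerrDoc 𝓢 E M a) (T' : ℝ) :
    ∃ (T : ℝ) (Ψ : Kerr.exterior M a → 𝓢.carrier), T' ≤ T ∧ Function.Injective Ψ ∧
      ContMDiff 𝓘(ℝ, E4) (𝓡 4) ∞ Ψ ∧ Set.range Ψ ⊆ E.doc ∧
      {q | q ∈ E.doc ∧ T < E.clock q} ⊆ Set.range Ψ ∧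
      (∀ x, 𝓢.deviation (Kerr.background M a) Ψ x = 0) ∧
        ∀ x : Kerr.exterior M a, 2 * M < Kerr.radius a x.1 →
          𝓢.timeOrientation.IsFutureDirected (mfderiv 𝓘(ℝ, E4) (𝓡 4) Ψ x (E4.basisVector 0)) := by
  obtain ⟨T, Ψ, hinj, hsmooth, hrange, hlate, hdev, hfut⟩ := h
  exact ⟨max T T', Ψ, le_max_right _ _, hinj, hsmooth, hrange,
    fun q hq ↦ hlate ⟨hq.1, (le_max_left _ _).trans_lt hq.2⟩, hdev, hfut⟩

/-- A threshold below the clock range of the d.o.c. gives back an exactly-Kerr d.o.c.: if the late part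
`{clock > T}` of the witness is all of `E.doc`, the chart is onto `E.doc`. [cite: DafermosLuk2017, Conjecture 1] -/
theorem isKerrDoc_of_isEventuallyKerrDoc_of_forall_lt {𝓢 : Spacetime.{0} 4} {E : EndDatum 𝓢} {M a : ℝ}
    (h : ∃ (T : ℝ) (Ψ : Kerr.exterior M a → 𝓢.carrier), (∀ q ∈ E.doc, T < E.clock q) ∧
      Function.Injective Ψ ∧ ContMDiff 𝓘(ℝ, E4) (𝓡 4) ∞ Ψ ∧ Set.range Ψ ⊆ E.doc ∧
      {q | q ∈ E.doc ∧ T < E.clock q} ⊆ Set.range Ψ ∧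
      (∀ x, 𝓢.deviation (Kerr.background M a) Ψ x = 0) ∧
        ∀ x : Kerr.exterior M a, 2 * M < Kerr.radius a x.1 →
          𝓢.timeOrientation.IsFutureDirected (mfderiv 𝓘(ℝ, E4) (𝓡 4) Ψ x (E4.basisVector 0))) :
    IsKerrDoc 𝓢 E.doc M a := by
  obtain ⟨T, Ψ, hT, hinj, hsmooth, hrange, hlate, hdev, hfut⟩ := h
  exact ⟨Ψ, hinj, hsmooth, hrange.antisymm fun q hq ↦ hlate ⟨hq, hT q hq⟩, hdev, hfut⟩

end Summit.FinalStateConjecture.FinalStateConjecture.Theorems.TameHull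

namespace Summit.FinalStateConjecture.FinalStateConjecture.Theorems.DarkFuture

open Literature.Geometry.Lorentzian
open Summit.FinalStateConjecture.FinalStateConjecture.Theorems.TameHull

/-- `(M, a) ↦ r₊(M, a) = M + √(M² − a²)` is continuous. [cite: arXiv07060622, §3] -/
theorem continuous_rPlus : Continuous fun p : ℝ × ℝ ↦ Kerr.rPlus p.1 p.2 := by
  unfold Kerr.rPlus
  fun_prop

/-- **B′ is antitone in the depth.** For fixed class, target `(M, a)` and depths `ρ ≤ ρ' < r₊(M, a)`: the body of
B′ (`∃ k β, β < 2 ∧ ∀ ε ∃ δ ∀ (M', a') δ-near ∀ 𝓢 E c, tame → silent → slab-close from the depth → exactly Kerr`)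
at depth `ρ'` implies the body at depth `ρ` — shrink `δ` so that `ρ' < r₊(M', a')` for all `δ`-near parameters
(`continuous_rPlus`), restrict the slab chart (`IsSlabClose.of_depth_le`) and relax the tolerance
(`IsSlabClose.mono`). So B′ `∀ ρ ∈ (r₋, r₊)` is equivalent to B′ for depths arbitrarily close to `r₊` (thin collars).
[cite: KlainermanSzeftel2023, Thm. 1.2.1] -/
theorem darkFutureExactnessAt_of_depth_le : ∀ (Λ : ℕ → ℝ≥0) (r₀ M a ρ ρ' : ℝ), ρ ≤ ρ' → ρ' < Kerr.rPlus M a → (∃ (k : ℕ) (β : ℝ), β < 2 ∧ ∀ ε > (0 : ℝ), ∃ δ > (0 : ℝ), ∀ M' a' : ℝ, |M' - M| + |a' - a| ≤ δ → ∀ (𝓢 : Spacetime.{0} 4) (E : EndDatum 𝓢) (c : ℝ), IsTameClass E Λ r₀ → E.IsSilent → IsSlabClose 𝓢 E M' a' ρ' k β c δ → ∃ M'' a'' : ℝ, 0 < M'' ∧ |a''| < M'' ∧ |M'' - M| + |a'' - a| ≤ ε ∧ IsKerrDoc 𝓢 E.doc M'' a'') → ∃ (k : ℕ) (β : ℝ),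 β < 2 ∧ ∀ ε > (0 : ℝ), ∃ δ > (0 : ℝ), ∀ M' a' : ℝ, |M' - M| + |a' - a| ≤ δ → ∀ (𝓢 : Spacetime.{0} 4) (E : EndDatum 𝓢) (c : ℝ), IsTameClass E Λ r₀ → E.IsSilent → IsSlabClose 𝓢 E M' a' ρ k β c δ → ∃ M'' a'' : ℝ, 0 < M'' ∧ |a''| < M'' ∧ |M'' - M| + |a'' - a| ≤ ε ∧ IsKerrDoc 𝓢 E.doc M'' a'' := by
  intro Λ r₀ M a ρ ρ' hρ hρ' h
  obtain ⟨k, β, hβ, h⟩ := h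
  refine ⟨k, β, hβ, fun ε hε ↦ ?_⟩
  obtain ⟨δ₁, hδ₁, h₁⟩ := h ε hε
  -- parameters near `(M, a)` keep `ρ'` below their outer horizon radius
  have hopen : IsOpen {p : ℝ × ℝ | ρ' < Kerr.rPlus p.1 p.2} := isOpen_lt continuous_const continuous_rPlus
  obtain ⟨r, hr, hball⟩ := Metric.isOpen_iff.1 hopen (M, a) hρ'
  refine ⟨min δ₁ (r / 2), lt_min hδ₁ (half_pos hr), fun M' a' hnear 𝓢 E c hcls hsil hslab ↦ ?_⟩
  have hmem : (M', a') ∈ Metric.ball (M, a) r := by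
    rw [Metric.mem_ball, Prod.dist_eq, Real.dist_eq, Real.dist_eq]
    have h2 : |M' - M| + |a' - a| < r :=
      (hnear.trans (min_le_right _ _)).trans_lt (half_lt_self hr)
    exact max_lt (by linarith [abs_nonneg (a' - a)]) (by linarith [abs_nonneg (M' - M)])
  have hlt : ρ' < Kerr.rPlus M' a' := hball hmem
  exact h₁ M' a' (hnear.trans (min_le_left _ _)) 𝓢 E c hcls hsil
    ((hslab.of_depth_le hρ hlt.le).mono (min_le_left _ _))

/-! ### §2 Tightness: the flat end is an all-orders class member, silent, with no Kerr d.o.c.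

The flat end datum of Minkowski spacetime is written out as the term
`EndDatum.mk 0 1 0 Subtype.val (fun x ↦ x 0)` (`M = 0`, `R = 1`, `C = 0`, far chart the inclusion of the cylinder
`Kerr.region 0 1`, clock `x⁰`), exactly as in `…RFlatEndExplicit` (no definition, no notation). -/

/-- **The flat end lies in every all-orders class `(Λ, r₀)` with `1 ≤ Λ 0`, `r₀ > 0`**: it is `(Λ 3, r₀)`-tame
(`FlatEnd.isTameEnd_flatEnd`), its far constants are `R = 1 ≤ Λ 0`, `C = 0 ≤ Λ 0`, and at every order `k` its
weighted far bounds hold with any constant and it has clock-adapted centred tame balls of deviation `0`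
(`FlatEnd.far_bound_flatEnd`, `FlatEnd.tameBall_flatEnd`). [cite: Anderson2004, Def. 1.1] -/
theorem isTameClass_flatEnd (Λ : ℕ → ℝ≥0) (hΛ : 1 ≤ ((Λ 0 : ℝ≥0) : ℝ)) {r₀ : ℝ} (hr₀ : 0 < r₀) :
    IsTameClass (EndDatum.mk 0 1 0 Subtype.val (fun x : E4 ↦ x 0) : EndDatum Minkowski.spacetime) Λ r₀ where
  isTameEnd := FlatEnd.isTameEnd_flatEnd (Λ 3) hr₀
  R_le := hΛ
  C_le := (Λ 0).coe_nonneg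
  order k := ⟨FlatEnd.far_bound_flatEnd k (Λ k), fun q _ ↦ FlatEnd.tameBall_flatEnd k (Λ k) hr₀ q⟩

/-- **A silent all-orders class member without Kerr d.o.c.**: for `1 ≤ Λ 0`, `r₀ > 0` the flat end is in
`IsTameClass Λ r₀`, silent, with `doc = ℝ⁴`, and Minkowski spacetime carries no exact Kerr exterior of positive
mass (`FlatEnd.not_isKerrDoc_minkowski`: Kretschmann `48M²/r⁶ ≠ 0`). [cite: arXiv07060622, §3] -/
theorem exists_isTameClass_silent_not_isKerrDoc (Λ : ℕ → ℝ≥0) (hΛ : 1 ≤ ((Λ 0 : ℝ≥0) : ℝ)) {r₀ : ℝ}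
    (hr₀ : 0 < r₀) :
    ∃ E : EndDatum Minkowski.spacetime, IsTameClass E Λ r₀ ∧ E.IsSilent ∧ E.doc = Set.univ ∧
      ∀ (O : Set Minkowski.spacetime.carrier) (M a : ℝ), 0 < M → ¬ IsKerrDoc Minkowski.spacetime O M a :=
  ⟨(EndDatum.mk 0 1 0 Subtype.val (fun x : E4 ↦ x 0) : EndDatum Minkowski.spacetime),
    isTameClass_flatEnd Λ hΛ hr₀, FlatEnd.isSilent_flatEnd, FlatEnd.doc_flatEnd,
    fun _ _ _ hM ↦ FlatEnd.not_isKerrDoc_minkowski hM⟩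

/-- **Tightness of B′, class-wise.** In EVERY all-orders class with `1 ≤ Λ 0`, `r₀ > 0`, for every target `(M, a)`
and tolerance `ε`, the statement "every silent class member has a sub-extremal Kerr d.o.c. `ε`-near `(M, a)`" is
false (the flat end): the slab hypothesis of B′ is load-bearing in every such class. [cite: Anderson2004, Def. 1.1] -/
theorem not_darkFutureExactness_without_slab_of_le (Λ : ℕ → ℝ≥0) (hΛ : 1 ≤ ((Λ 0 : ℝ≥0) : ℝ)) {r₀ : ℝ}
    (hr₀ : 0 < r₀) (M a ε : ℝ) :
    ¬ ∀ (𝓢 : Spacetime.{0} 4) (E : EndDatum 𝓢), IsTameClass E Λ r₀ → E.IsSilent →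
      ∃ M'' a'' : ℝ, 0 < M'' ∧ |a''| < M'' ∧ |M'' - M| + |a'' - a| ≤ ε ∧ IsKerrDoc 𝓢 E.doc M'' a'' := by
  intro h
  obtain ⟨M'', a'', hM'', -, -, hdocK⟩ :=
    h Minkowski.spacetime (EndDatum.mk 0 1 0 Subtype.val (fun x : E4 ↦ x 0) : EndDatum Minkowski.spacetime)
      (isTameClass_flatEnd Λ hΛ hr₀) FlatEnd.isSilent_flatEnd
  exact FlatEnd.not_isKerrDoc_minkowski hM'' hdocK

/-- **Registered sub-goal: B′ with the hypothesis `IsSlabClose` deleted is FALSE** (verbatim text of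
`stub_darkFutureExactness` minus the one hypothesis `IsSlabClose 𝓢 E M' a' ρ k β c δ →`; the then dead binder `k` is
written `_`). Witness: class `Λ ≡ 1`,
`r₀ = 1`, target Schwarzschild `(M, a) = (1, 0)`, depth `ρ = 1 ∈ (r₋, r₊) = (0, 2)`, `ε = 1`, centre `(M', a') = (1, 0)`,
epoch `c = 0`, and the flat end of Minkowski spacetime (`isTameClass_flatEnd`, `FlatEnd.isSilent_flatEnd`,
`FlatEnd.not_isKerrDoc_minkowski`). [cite: Anderson2004, Def. 1.1] -/
theorem not_darkFutureExactness_without_slab : ¬ ∀ (Λ : ℕ → ℝ≥0) (r₀ : ℝ) (M a : ℝ), 0 < M → |a| < M → ∀ ρ : ℝ, Kerr.rMinus M a < ρ → ρ < Kerr.rPlus M a → ∃ (_ : ℕ) (β : ℝ), β < 2 ∧ ∀ ε > (0 : ℝ), ∃ δ > (0 : ℝ), ∀ M' a' : ℝ, |M' - M| + |a' - a| ≤ δ → ∀ (𝓢 : Spacetime.{0} 4) (E : EndDatum 𝓢) (c : ℝ), IsTameClass E Λ r₀ → E.IsSilent → ∃ M'' a'' : ℝ, 0 < M'' ∧ |a''|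 < M'' ∧ |M'' - M| + |a'' - a| ≤ ε ∧ IsKerrDoc 𝓢 E.doc M'' a'' := by
  intro h
  have hρ₁ : Kerr.rMinus 1 0 < 1 := by norm_num [Kerr.rMinus]
  have hρ₂ : (1 : ℝ) < Kerr.rPlus 1 0 := by norm_num [Kerr.rPlus]
  obtain ⟨_, _, -, hε⟩ := h (fun _ ↦ 1) 1 1 0 one_pos (by norm_num) 1 hρ₁ hρ₂
  obtain ⟨δ, hδ, hδ'⟩ := hε 1 one_pos
  obtain ⟨M'', a'', hM'', -, -, hdocK⟩ := hδ' 1 0 (by simpa using hδ.le) Minkowski.spacetime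
    (EndDatum.mk 0 1 0 Subtype.val (fun x : E4 ↦ x 0) : EndDatum Minkowski.spacetime) 0
    (isTameClass_flatEnd (fun _ ↦ 1) (by simp) one_pos) FlatEnd.isSilent_flatEnd
  exact FlatEnd.not_isKerrDoc_minkowski hM'' hdocK

/-! ### §3 The slab hypothesis at order `≥ 2` excludes every end of Minkowski spacetime -/

/-- An equatorial point of the chart slab of `Kerr.region a r₁`: `x = (0, R, 0, 0)` with `R = |a| + |r₁| + 1` has
Kerr–Schild radius `r` with `r² = R² − a² > r₁²`, so `r > max r₁ 0`, and `x³ = 0`, `x⁰ = 0`.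
[cite: arXiv07060622, §3] -/
theorem exists_equatorial_mem_region (a r₁ : ℝ) :
    ∃ x : E4, x ∈ (Kerr.region a r₁ : Set E4) ∧ x 3 = 0 ∧ x 0 = 0 := by
  -- adapted from `FlatEnd.exists_equatorial_mem_exterior` (`r₊ ↦ r₁`)
  set R : ℝ := |a| + |r₁| + 1 with hR
  set x : E4 := (WithLp.equiv 2 (Fin 4 → ℝ)).symm ![0, R, 0, 0] with hx
  have hx1 : x 1 = R := rfl
  have hx0 : x 0 = 0 := rfl
  have hx2 : x 2 = 0 := rfl
  have hx3 : x 3 = 0 := rfl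
  have hRpos : 0 < R := by positivity
  have hsn : E4.spatialNorm x = R := by
    rw [E4.spatialNorm, EuclideanSpace.norm_eq]
    simp only [E4.spatial_apply, Fin.sum_univ_three, Real.norm_eq_abs, sq_abs]
    rw [show x (Fin.succ 0) = R from hx1, show x (Fin.succ 1) = 0 from hx2,
      show x (Fin.succ 2) = 0 from hx3]
    simp only [ne_eq, OfNat.ofNat_ne_zero, not_false_eq_true, zero_pow, add_zero]
    exact Real.sqrt_sq hRpos.le
  have hRa : a ^ 2 ≤ R ^ 2 := by
    rw [sq_le_sq, abs_of_pos hRpos, hR]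
    linarith [abs_nonneg r₁]
  have hr2 : Kerr.radius a x ^ 2 = R ^ 2 - a ^ 2 := by
    rw [Kerr.radius, Real.sq_sqrt, hsn, hx3]
    · have : (R ^ 2 - a ^ 2) ^ 2 + 4 * a ^ 2 * 0 ^ 2 = (R ^ 2 - a ^ 2) ^ 2 := by ring
      rw [this, Real.sqrt_sq (sub_nonneg.mpr hRa)]
      ring
    · rw [hsn, hx3]
      have : (R ^ 2 - a ^ 2) ^ 2 + 4 * a ^ 2 * 0 ^ 2 = (R ^ 2 - a ^ 2) ^ 2 := by ring
      rw [this, Real.sqrt_sq (sub_nonneg.mpr hRa)]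
      linarith [sub_nonneg.mpr hRa]
  refine ⟨x, ?_, hx3, hx0⟩
  rw [SetLike.mem_coe, Kerr.mem_region]
  have hrnn : 0 ≤ Kerr.radius a x := Kerr.radius_nonneg a x
  have hlt : max r₁ 0 ^ 2 < Kerr.radius a x ^ 2 := by
    rw [hr2]
    have hm : max r₁ 0 ≤ |r₁| := max_le (le_abs_self _) (abs_nonneg _)
    have hm0 : 0 ≤ max r₁ 0 := le_max_right _ _
    nlinarith [abs_nonneg a, abs_nonneg r₁, sq_abs a]
  exact lt_of_pow_lt_pow_left₀ 2 hrnn hlt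

/-- **Registered sub-goal: no end of Minkowski spacetime is slab-close at order `≥ 2` to a Kerr of positive mass.**
For `M > 0`, every `a`, every depth `ρ`, every order `k ≥ 2` and weight `β` there is `δ > 0` such that for every
end datum `E` of Minkowski spacetime, every epoch `c` and every `δ' ≤ δ`, `¬ IsSlabClose Minkowski.spacetime E M a ρ k β c δ'`:
at the equatorial point `x₀ = (0, R, 0, 0)` of the chart slab `{|t*| < 2}` the weighted jets
`‖D^m(Ψ^*η − g_{M,a})(x₀)‖ · r^{β+m}`, `m ≤ k`, of ANY smooth chart cannot all be `≤ δ`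
(`HullCurvature.not_forall_weighted_jets_le_of_flatChart`: the flat chart metric has zero curvature, `g_{M,a}` has
Kretschmann `48M²/r⁶ > 0` there). With §2: the flat end refutes B′ without its slab hypothesis, and is excluded by it
exactly when the order is `≥ 2`. [cite: Kotschwar2014, §1.1 (8)] -/
theorem not_isSlabClose_minkowski_of_two_le : ∀ (M a ρ : ℝ), 0 < M → ∀ (k : ℕ), 2 ≤ k → ∀ (β : ℝ), ∃ δ > (0 : ℝ), ∀ (E : EndDatum Minkowski.spacetime) (c δ' : ℝ), δ' ≤ δ → ¬ IsSlabClose Minkowski.spacetime E M a ρ k β c δ' := by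
  intro M a ρ hM k hk β
  obtain ⟨x₀, hx₀, h3, h0⟩ := exists_equatorial_mem_region a ρ
  obtain ⟨δ, hδ, hjet⟩ :=
    HullCurvature.not_forall_weighted_jets_le_of_flatChart M a ρ hM ⟨x₀, hx₀⟩ h3 k hk β
  refine ⟨δ, hδ, fun E c δ' hδ' hslab ↦ ?_⟩
  obtain ⟨Ψ, -, hsm, -, -, hdev, -⟩ := hslab
  refine hjet Ψ Set.univ isOpen_univ (Set.mem_univ _) hsm.contMDiffOn fun m hm ↦ ?_
  have hx00 : |(⟨x₀, hx₀⟩ : Kerr.region a ρ).1 0| < 2 := by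
    change |x₀ 0| < 2
    rw [h0, abs_zero]
    exact two_pos
  exact (hdev m hm ⟨x₀, hx₀⟩ hx00).trans hδ'

/-- **Corollary (the flat end and B′).** For the explicit flat end: it is a silent member of every class with
`1 ≤ Λ 0`, it has no sub-extremal Kerr d.o.c. at all, and for `M > 0`, `k ≥ 2` it is not `δ`-slab-close to Kerr
`(M, a)` from any depth for small `δ` — the known witness against the slab-less statement is consistent with B′.
[cite: Kotschwar2014, §1.1 (8)] -/
theorem flatEnd_consistent_with_darkFutureExactness (Λ : ℕ → ℝ≥0) (hΛ : 1 ≤ ((Λ 0 : ℝ≥0) : ℝ)) {r₀ : ℝ}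
    (hr₀ : 0 < r₀) {M : ℝ} (a ρ : ℝ) (hM : 0 < M) {k : ℕ} (hk : 2 ≤ k) (β : ℝ) :
    IsTameClass (EndDatum.mk 0 1 0 Subtype.val (fun x : E4 ↦ x 0) : EndDatum Minkowski.spacetime) Λ r₀ ∧
      EndDatum.IsSilent (EndDatum.mk 0 1 0 Subtype.val (fun x : E4 ↦ x 0) : EndDatum Minkowski.spacetime) ∧
      (¬ ∃ M'' a'' : ℝ, 0 < M'' ∧ |a''| < M'' ∧ IsKerrDoc Minkowski.spacetime
        (EndDatum.doc (EndDatum.mk 0 1 0 Subtype.val (fun x : E4 ↦ x 0) : EndDatum Minkowski.spacetime)) M'' a'') ∧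
      ∃ δ > (0 : ℝ), ∀ c : ℝ, ¬ IsSlabClose Minkowski.spacetime
        (EndDatum.mk 0 1 0 Subtype.val (fun x : E4 ↦ x 0) : EndDatum Minkowski.spacetime) M a ρ k β c δ := by
  obtain ⟨δ, hδ, h⟩ := not_isSlabClose_minkowski_of_two_le M a ρ hM k hk β
  exact ⟨isTameClass_flatEnd Λ hΛ hr₀, FlatEnd.isSilent_flatEnd,
    fun ⟨M'', a'', hM'', _, hK⟩ ↦ FlatEnd.not_isKerrDoc_minkowski hM'' hK, δ, hδ, fun c ↦ h _ c δ le_rfl⟩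

end Summit.FinalStateConjecture.FinalStateConjecture.Theorems.DarkFuture

end
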